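import Summits.ValiantsHypothesis.ValiantsHypothesis.Theorems.DefinabilityGapPivotLiveWeak
import HarnessLib

/-!
# DefinabilityGap — pivot certificates: liveness with a few crowded rows AND columns

Route `route-ValiantsHypothesis-DefinabilityGap`, residual crux `KIPlantedHitting` (item 23547),
rung `R_K1.1`, ROAD P, existence step N1 (NODE-v7 §H).  `DefinabilityGapPivotLiveWeak` allowed a
bounded number of crowded ROWS in the minor of `S_c`; the same incidence count that bounds them
(`DefinabilityGapPivotAdmissible.sum_card_coCurves_le`) allows equally few crowded COLUMNS, whose
free rows may drop below `(m−1)/2`.  This file proves the symmetric criterion the probabilistic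
row assignment is designed to meet: Hall's condition on the minor holds as soon as
* every GOOD column (`j ≠ s₀` not in `badCols`) has `≥ (m−1)/2` free rows and every GOOD row
  (`i ≠ r` not in `badRows`) has `< m/2` killed cells — these are the definitions;
* every bad column keeps at least `#badCols` free rows (`hcolbad`);
* every bad row keeps at least `#badRows` free cells (`hrowbad`).
(`liveAt_of_fewBad`; small column sets are matched inside one good column or, if all bad, by the
bad-column bound; large ones reach every good row and miss a bad row only by avoiding all its
free cells.)  Certificate-level corollary `kiPivotCertificate_of_fewBad`.
-/

noncomputable section

open Finset
open Literature.Computability.AlgebraicComplexity Literature.Computability.MetaComplexity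
open Summit.ValiantsHypothesis.ValiantsHypothesis.Theorems.DefinabilityGapAffineRung
open Summit.ValiantsHypothesis.ValiantsHypothesis.Theorems.DefinabilityGapSupportRung
open Summit.ValiantsHypothesis.ValiantsHypothesis.Theorems.DefinabilityGapPivotCertificate
open Summit.ValiantsHypothesis.ValiantsHypothesis.Theorems.DefinabilityGapPivotLive
open Summit.ValiantsHypothesis.ValiantsHypothesis.Theorems.DefinabilityGapPivotLiveWeak

namespace Summit.ValiantsHypothesis.ValiantsHypothesis.Theorems.DefinabilityGapPivotLiveBad

variable {m : ℕ}

/-- The BAD (crowded) columns of the minor of `S_c` (row `r`, column `s₀` deleted): columns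
`j ≠ s₀` with fewer than `(m−1)/2` free rows. [this file] -/
def badCols (W : Finset (Fin (qOf m) × Fin (qOf m))) (c : Fin 3 → Fin (qOf m)) (r s₀ : Fin m) :
    Finset (Fin m) :=
  univ.filter fun j => j ≠ s₀ ∧ 2 * (okRows W c r j).card + 1 < m

/-- Membership in the bad columns. [this file] -/
theorem mem_badCols {W : Finset (Fin (qOf m) × Fin (qOf m))} {c : Fin 3 → Fin (qOf m)}
    {r s₀ j : Fin m} : j ∈ badCols W c r s₀ ↔ j ≠ s₀ ∧ 2 * (okRows W c r j).card + 1 < m := by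
  simp [badCols]

/-- **Liveness with few bad rows and columns.** [this file] -/
theorem liveAt_of_fewBad (W : Finset (Fin (qOf m) × Fin (qOf m))) (c : Fin 3 → Fin (qOf m))
    (r s₀ : Fin m) (hpiv : cellEmb m c (r, s₀) ∉ W)
    (hcolbad : ∀ j ∈ badCols W c r s₀, (badCols W c r s₀).card ≤ (okRows W c r j).card)
    (hrowbad : ∀ i ∈ badRows W c r s₀,
      (badRows W c r s₀).card + (deadCols W c s₀ i).card + 1 ≤ m) :
    LiveAt m W c (r, s₀) := by
  classical
  -- Hall's condition for the columns `j ≠ s₀` into the free rows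
  have hH : ∀ S : Finset {j : Fin m // j ≠ s₀},
      S.card ≤ (S.biUnion fun j => okRows W c r j.1).card := by
    intro S
    rcases S.eq_empty_or_nonempty with rfl | ⟨j₀, hj₀⟩
    · simp
    -- `|S| ≤ m - 1`
    have hS' : (S.map (Function.Embedding.subtype _)).card ≤ (Finset.univ.erase s₀).card :=
      Finset.card_le_card fun j hj => by
        obtain ⟨j', _, rfl⟩ := Finset.mem_map.mp hj
        exact Finset.mem_erase.mpr ⟨j'.2, Finset.mem_univ _⟩
    rw [Finset.card_map, Finset.card_erase_of_mem (Finset.mem_univ _), Finset.card_univ,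
      Fintype.card_fin] at hS'
    have hin : ∀ j ∈ S, (okRows W c r j.1).card ≤ (S.biUnion fun j => okRows W c r j.1).card :=
      fun j hj => Finset.card_le_card fun i hi => Finset.mem_biUnion.mpr ⟨j, hj, hi⟩
    by_cases hS : 2 * S.card + 1 ≤ m
    · by_cases hgood : ∃ j ∈ S, j.1 ∉ badCols W c r s₀
      · -- a good column alone absorbs a small set
        obtain ⟨j, hjS, hj⟩ := hgood
        have h1 : S.card ≤ (okRows W c r j.1).card := by
          have h2 : ¬ (2 * (okRows W c r j.1).card + 1 < m) := fun h =>
            hj (mem_badCols.mpr ⟨j.2, h⟩)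
          omega
        exact h1.trans (hin j hjS)
      · -- all columns of `S` are bad: `|S| ≤ #badCols ≤ #okRows j₀`
        push Not at hgood
        have hsub : S.map (Function.Embedding.subtype _) ⊆ badCols W c r s₀ := by
          intro j hj
          obtain ⟨j', hj'S, rfl⟩ := Finset.mem_map.mp hj
          exact hgood j' hj'S
        have h1 := Finset.card_le_card hsub
        rw [Finset.card_map] at h1
        exact (h1.trans (hcolbad _ (hgood j₀ hj₀))).trans (hin j₀ hj₀)
    · -- a row `i ≠ r` missed by `S` has all its `S`-cells killed: it is bad, with few free cells
      have hmiss : ∀ i, i ≠ r → i ∉ (S.biUnion fun j => okRows W c r j.1) →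
          i ∈ badRows W c r s₀ ∧ S.card ≤ (deadCols W c s₀ i).card := by
        intro i hir hnot
        have hsub : S.map (Function.Embedding.subtype _) ⊆ deadCols W c s₀ i := by
          intro j hj
          obtain ⟨j', hj'S, rfl⟩ := Finset.mem_map.mp hj
          refine mem_deadCols.mpr ⟨j'.2, ?_⟩
          by_contra hW
          exact hnot (Finset.mem_biUnion.mpr ⟨j', hj'S, mem_okRows.mpr ⟨hir, hW⟩⟩)
        have h1 := Finset.card_le_card hsub
        rw [Finset.card_map] at h1
        exact ⟨mem_badRows.mpr ⟨hir, by omega⟩, h1⟩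
      by_cases hall : Finset.univ.erase r ⊆ S.biUnion fun j => okRows W c r j.1
      · refine le_trans ?_ (Finset.card_le_card hall)
        rw [Finset.card_erase_of_mem (Finset.mem_univ _), Finset.card_univ, Fintype.card_fin]
        exact hS'
      · obtain ⟨i, hi, hin'⟩ := Finset.not_subset.mp hall
        have hir : i ≠ r := Finset.ne_of_mem_erase hi
        obtain ⟨hib, hSi⟩ := hmiss i hir hin'
        have hbi := hrowbad i hib
        have hcover : Finset.univ.erase r ⊆
            (S.biUnion fun j => okRows W c r j.1) ∪ badRows W c r s₀ := by
          intro i' hi'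
          by_cases h' : i' ∈ S.biUnion fun j => okRows W c r j.1
          · exact Finset.mem_union_left _ h'
          · exact Finset.mem_union_right _ (hmiss i' (Finset.ne_of_mem_erase hi') h').1
        have h2 := (Finset.card_le_card hcover).trans (Finset.card_union_le _ _)
        rw [Finset.card_erase_of_mem (Finset.mem_univ _), Finset.card_univ, Fintype.card_fin]
          at h2
        omega
  obtain ⟨g, hg, hgt⟩ := (Finset.all_card_le_biUnion_card_iff_exists_injective _).mp hH
  -- the transversal: column `s₀ ↦ r`, column `j ≠ s₀ ↦ g j`
  let G : Fin m → Fin m := fun j => if h : j = s₀ then r else g ⟨j, h⟩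
  have hGne : ∀ j (h : j ≠ s₀), G j ≠ r := by
    intro j h
    simp only [G, dif_neg h]
    exact (mem_okRows.mp (hgt ⟨j, h⟩)).1
  have hGinj : Function.Injective G := by
    intro j j' h
    by_cases hj : j = s₀ <;> by_cases hj' : j' = s₀
    · rw [hj, hj']
    · exact absurd (by simpa [G, hj] using h.symm) (hGne j' hj')
    · exact absurd (by simpa [G, hj'] using h) (hGne j hj)
    · have h' : g ⟨j, hj⟩ = g ⟨j', hj'⟩ := by simpa [G, hj, hj'] using h
      exact congrArg Subtype.val (hg h')
  refine ⟨Equiv.ofBijective G (Finite.injective_iff_bijective.mp hGinj), fun j => ?_, ?_⟩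
  · rw [Equiv.ofBijective_apply]
    by_cases hj : j = s₀
    · subst hj
      simpa [G] using hpiv
    · simp only [G, dif_neg hj]
      exact (mem_okRows.mp (hgt ⟨j, hj⟩)).2
  · rw [Equiv.ofBijective_apply]
    simp [G]

/-- With the half-degree column loads there is no bad column. [this file] -/
theorem badCols_eq_empty_of_halfDegree {W : Finset (Fin (qOf m) × Fin (qOf m))}
    {c : Fin 3 → Fin (qOf m)} {r s₀ : Fin m}
    (hcol : ∀ j, j ≠ s₀ → m ≤ 2 * (okRows W c r j).card + 1) : badCols W c r s₀ = ∅ := by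
  ext j
  simp only [mem_badCols, Finset.notMem_empty, iff_false, not_and, not_lt]
  exact hcol j

/-- **Pivot certificate from distinct pivots and few bad rows / columns.** [this file] -/
theorem kiPivotCertificate_of_fewBad (T : Finset (Fin 3 → Fin (qOf m))) (s₀ : Fin m)
    (r : (Fin 3 → Fin (qOf m)) → Fin m)
    (hinj : ∀ c ∈ T, ∀ c' ∈ T, cellEmb m c (r c, s₀) = cellEmb m c' (r c', s₀) → c = c')
    (hcolbad : ∀ c ∈ T, ∀ j ∈ badCols (pivotZeros m T s₀ r) c (r c) s₀,
      (badCols (pivotZeros m T s₀ r) c (r c) s₀).card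
        ≤ (okRows (pivotZeros m T s₀ r) c (r c) j).card)
    (hrowbad : ∀ c ∈ T, ∀ i ∈ badRows (pivotZeros m T s₀ r) c (r c) s₀,
      (badRows (pivotZeros m T s₀ r) c (r c) s₀).card
        + (deadCols (pivotZeros m T s₀ r) c s₀ i).card + 1 ≤ m) :
    KIPivotCertificate m T s₀ r :=
  ⟨hinj, fun c hc => liveAt_of_fewBad _ c (r c) s₀ (pivot_not_mem_pivotZeros T s₀ r c)
    (hcolbad c hc) (hrowbad c hc)⟩

end Summit.ValiantsHypothesis.ValiantsHypothesis.Theorems.DefinabilityGapPivotLiveBad
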